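import Literature.Computability.Complexity.CookBridges

/-!
# PneNP / SzkEntropy — support `CookModelBridge` (stmt-PneNP-13908), route-independent proof

Route `PneNP/SzkEntropy`, support item stmt-PneNP-13908 (`CookModelBridge`, rev-3 re-filing of the
proved stmt-PneNP-10679):

  `PNPWave0.P Bool = Classes.P ∧ PNPWave0.NP Bool = Nondeterministic.NP`.

Cook's Clay-problem classes over `{0,1}` (in which the summit statement `PneNP` is phrased) coincide
with the tree's working classes `Classes.P = ⋃ₖ DTIME(nᵏ)` and `Nondeterministic.NP = polyExists P`.
Both equalities are PROVED Literature theorems (`p_bool_eq`, `CookBridges.np_bool_eq` of the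
conjecture-free module `CookBridges.lean`).

This file deliberately imports NEITHER the route file `Summits.PneNP.PneNP.Theses.SzkEntropy` NOR any
`Theorems/SzkEntropy*.lean`: the earlier proof `cookModelBridge_proof`
(`Theorems/SzkEntropyCookModelBridge.lean`) imports the route file, and the gate links a proved item
by importing the proving module INTO the route file, which closed an import cycle (route rev 3,
2026-08-15).  The statement is therefore spelled structurally, exactly as the item's signature.

References: S. Cook, *The P versus NP problem* (Clay problem description, 2000), §1;
S. Arora, B. Barak, *Computational Complexity: A Modern Approach* (2009), Def. 1.13, Def. 2.1,
Claim 1.5.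
-/

namespace Summit.PneNP.PneNP.Theorems

open Literature.Computability.Complexity

/-- **`CookModelBridge` holds** (route `SzkEntropy`, item stmt-PneNP-13908; same term as
stmt-PneNP-10679): `PNPWave0.P Bool = Classes.P ∧ PNPWave0.NP Bool = Nondeterministic.NP`, the pair
of the proved model bridges `p_bool_eq` and `CookBridges.np_bool_eq`.
[CookClay2000, §1; AroraBarakCC2009, Def. 1.13, Def. 2.1, Claim 1.5] -/
theorem szkEntropy_cookModelBridge_standalone :
    And (PNPWave0.P Bool = Classes.P) (PNPWave0.NP Bool = Nondeterministic.NP) :=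
  ⟨p_bool_eq, CookBridges.np_bool_eq⟩

end Summit.PneNP.PneNP.Theorems
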